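import Summits.QuantumAdvantage.AdviceFreeQNC0.LongGridCycle
import Summits.QuantumAdvantage.AdviceFreeQNC0.SqrtDegreeStatements
import Summits.QuantumAdvantage.AdviceFreeQNC0.AdviceFreeQNC0
import Summits.QuantumAdvantage.AdviceFreeQNC0.WalkTubeRank
import Literature.Computability.MetaComplexity.SmolenskyRelations
import Literature.Computability.QuantumComplexity.ShallowCircuitsEncodeProofs
import Literature.Computability.Complexity.Classes
import HarnessLib

/-!
# Cell qa-qnc0 (rung F-Q1-exp): the EXPONENTIAL bridge `LongGridCycle → RingHardLinSqrt p → HLFNotFAC0ModExp p`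

Planner qa-qnc0-p2 g12, ROUND-12 §A / `Sketch12b.lean`: statement **P3 `ExpBridgePlan`** VERBATIM (E2 `RingHardLinSqrt`,
F-Q1-exp `HLFNotFAC0ModExp` are typed verbatim in `SqrtDegreeStatements.lean`), and the proofs

* `expBridge : ExpBridgePlan p` (every prime `p`; ROUND-12 §A.3 item E4) — the re-run of
  `RingFrameBridge.hlfNotFAC0Mod_of_ringHard8` on a LONG grid cycle: given `AC⁰[p]/rpoly` circuits for
  `N × N` 2D-HLF of depth `d` and size `≤ 2^M` with `c·(M + log₂ N)^{d+1} ≤ N`, restrict them to the cycle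
  instances `ringInstance γ x` of a grid cycle `γ` of length `n ≥ N²/4` (`LongGridCycle`); the input string is
  a projection of the pattern (`GridCycle.encodeHLF_ringInstance_subst`), so the relational Razborov–Smolensky
  lemma (`Smolensky.exists_uniformProb_le`) with `ℓ = M + 2(log₂ N + 1) + ⌈3/δ⌉` produces a pattern on which
  the success probability is `≤ θ₀ + N²(2^M + 2)/p^ℓ ≤ θ₀ + δ`, `δ = (1 - θ₀)/2`, because every polynomial
  map solving HLF on the cycle instance solves the ring relation on the cycle (`GridCycle.rel_of_mem_hlfSolutions`)
  and `RingHardLinSqrt p` (at slope `K = 1`) bounds those: the Razborov–Smolensky degree `((p-1)ℓ)^{d+1}` is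
  `≤ N/2 - 1 ≤ ⌊√n⌋` by the hypothesis `c·(M + log₂ N)^{d+1} ≤ N` with `c = 2((p-1)(⌈3/δ⌉ + 4))^{d+1} + 2`.
* `hlfNotFAC0Mod_of_exp : HLFNotFAC0ModExp p → HLFNotFAC0Mod p` (first half of Sketch12b P6 `ExpGivesPoly`):
  a polynomial size bound `s(N) ≤ c_s N^{k_s} + c_s` is `≤ 2^M` with `M = log₂ s(N) + 1 = O(log₂ N)`, and
  `c·(M + log₂ N)^{d+1} ≤ (log₂ N)^{d+2} ≤ ⌊√N⌋ ≤ N` eventually (`logPow_le_natSqrt`).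

So the exponential rung `HLFNotFAC0ModExp 2` (2D HLF versus depth-`d` `AC⁰[2]/rpoly` circuits of size
`2^{Ω(N^{1/(d+1)})}`, uniform random bits, NO advice on either side, one gap for all depths) is reduced in
the kernel to `RingHardLinSqrt 2` (ring hardness at `𝔽₂`-degree `⌊√n⌋`, Sketch12b P1 + P2 from the landed
tube bound) — `LongGridCycle` is a theorem (`LongGridCycle.lean`).

WHAT THIS IS NOT: no lower bound is proved here (`RingHardLinSqrt p` is a hypothesis; for `p = 2` it is
Sketch12b P1+P2, for odd `p` open); nothing on `GC⁰(k)[p]` (Sketch12b §5, E5); separation NOT moved.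
-/

noncomputable section

open Finset Polynomial
open Literature.Computability.Cryptography Literature.Computability.Complexity
open Literature.Computability.QuantumComplexity Literature.Computability.MetaComplexity

namespace Summit.QuantumAdvantage.AdviceFreeQNC0

/-! ### Statement (qa-qnc0-p2 Sketch12b §6 — verbatim; E2 / F-Q1-exp are in `SqrtDegreeStatements.lean`) -/

/-- **P3 `ExpBridgePlan p`** (Sketch12b §6, verbatim): the exponential bridge (any prime `p`). -/
def ExpBridgePlan (p : ℕ) [Fact p.Prime] : Prop :=
  LongGridCycle → RingHardLinSqrt p → HLFNotFAC0ModExp p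

/-! ### Arithmetic of the parameters -/

/-- `⌊N/2⌋ ≤ ⌊√n⌋` when `N² ≤ 4n`. -/
private theorem half_le_sqrt {N n : ℕ} (h : N * N ≤ 4 * n) : N / 2 ≤ Nat.sqrt n := by
  rw [Nat.le_sqrt]
  have h2 : 2 * (N / 2) ≤ N := Nat.mul_div_le N 2
  have h3 : 2 * (N / 2) * (2 * (N / 2)) ≤ N * N := Nat.mul_le_mul h2 h2
  nlinarith

/-- The Razborov–Smolensky parameter `ℓ = M + 2(L+1) + E` is `≤ (E + 4)(M + L)` once `L ≥ 1`. -/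
private theorem ell_le {M L E : ℕ} (hL : 1 ≤ L) : M + 2 * (L + 1) + E ≤ (E + 4) * (M + L) := by
  nlinarith

/-- The error term: `N²(2^M + 2) ≤ δ·p^ℓ` for `ℓ = M + 2(L+1) + E`, `L = log₂ N`, `3 ≤ δ·2^E`, `2 ≤ p`. -/
private theorem error_le {p N M E : ℕ} {δ : ℝ} (hp : 2 ≤ p) (hE : (3 : ℝ) ≤ δ * (2 : ℝ) ^ E) (hδ : 0 ≤ δ) :
    (N : ℝ) * N * ((2 : ℝ) ^ M + 2) ≤ δ * (p : ℝ) ^ (M + 2 * (Nat.log 2 N + 1) + E) := by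
  set L : ℕ := Nat.log 2 N with hL
  have hN2 : (N : ℝ) * N ≤ (2 : ℝ) ^ (2 * (L + 1)) := by
    have h := (Nat.lt_pow_succ_log_self one_lt_two N).le
    have h' : N * N ≤ 2 ^ (L + 1) * 2 ^ (L + 1) := Nat.mul_le_mul h h
    rw [← pow_add, show L + 1 + (L + 1) = 2 * (L + 1) by ring] at h'
    exact_mod_cast h'
  have hM3 : (2 : ℝ) ^ M + 2 ≤ 3 * (2 : ℝ) ^ M := by
    have : (1 : ℝ) ≤ (2 : ℝ) ^ M := one_le_pow₀ (by norm_num)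
    linarith
  have hpℓ : (2 : ℝ) ^ (M + 2 * (L + 1) + E) ≤ (p : ℝ) ^ (M + 2 * (L + 1) + E) := by
    exact_mod_cast Nat.pow_le_pow_left hp _
  calc (N : ℝ) * N * ((2 : ℝ) ^ M + 2)
      ≤ (2 : ℝ) ^ (2 * (L + 1)) * (3 * (2 : ℝ) ^ M) :=
        mul_le_mul hN2 hM3 (by positivity) (by positivity)
    _ = 3 * ((2 : ℝ) ^ M * (2 : ℝ) ^ (2 * (L + 1))) := by ring
    _ ≤ δ * (2 : ℝ) ^ E * ((2 : ℝ) ^ M * (2 : ℝ) ^ (2 * (L + 1))) :=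
        mul_le_mul_of_nonneg_right hE (by positivity)
    _ = δ * (2 : ℝ) ^ (M + 2 * (L + 1) + E) := by rw [pow_add, pow_add]; ring
    _ ≤ δ * (p : ℝ) ^ (M + 2 * (L + 1) + E) := mul_le_mul_of_nonneg_left hpℓ hδ

/-! ### The exponential bridge -/

/-- **`LongGridCycle → RingHardLinSqrt p → HLFNotFAC0ModExp p`** (ROUND-12 §A.3 E4): restricting `N × N`
2D-HLF circuits of size `≤ 2^M` to the cycle instances of a grid cycle of length `n ≥ N²/4` and applying the
relational Razborov–Smolensky lemma (tree `Smolensky.exists_uniformProb_le`) with `ℓ = M + 2(log₂ N + 1) + ⌈3/δ⌉`,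
the HLF→ring transfer (tree `GridCycle.rel_of_mem_hlfSolutions`) and the input projection (tree
`GridCycle.encodeHLF_ringInstance_subst`); the Razborov–Smolensky degree `((p-1)ℓ)^{d+1}` is `≤ ⌊√n⌋` by the
hypothesis `c·(M + log₂ N)^{d+1} ≤ N`.  Threshold `(1 + θ₀)/2` from the ring threshold `θ₀` at slope `K = 1`. -/
theorem hlfNotFAC0ModExp_of_ringHardLinSqrt (p : ℕ) [Fact p.Prime] (hL : LongGridCycle)
    (hR : RingHardLinSqrt p) : HLFNotFAC0ModExp p := by
  classical
  have hp := (Fact.out : p.Prime)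
  obtain ⟨N₁, hN₁⟩ := hL
  obtain ⟨θ₀, hθ₀, n₀, hn₀⟩ := hR 1
  set δ : ℝ := (1 - θ₀) / 2 with hδ
  have hδpos : 0 < δ := by rw [hδ]; linarith
  refine ⟨θ₀ + δ, by rw [hδ]; linarith, fun d => ?_⟩
  -- the constants: `E` with `3 ≤ δ·2^E`, and `c`
  set E : ℕ := ⌈3 / δ⌉₊ with hE
  have h3E : (3 : ℝ) ≤ δ * (2 : ℝ) ^ E := by
    have h1 : (3 : ℝ) / δ ≤ E := by rw [hE]; exact Nat.le_ceil _
    have h2 : (E : ℝ) ≤ (2 : ℝ) ^ E := by exact_mod_cast (@Nat.lt_two_pow_self E).le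
    have h3 : (3 : ℝ) / δ ≤ (2 : ℝ) ^ E := h1.trans h2
    rw [div_le_iff₀ hδpos] at h3
    linarith
  set A : ℕ := ((p - 1) * (E + 4)) ^ (d + 1) with hA
  refine ⟨2 * A + 2, max (max 4 N₁) (2 * n₀ + 2), fun N hN M hcM r Cs hover hdep hsize => ?_⟩
  have hN4 : 4 ≤ N := le_trans (le_max_left _ _) (le_trans (le_max_left _ _) hN)
  have hNN₁ : N₁ ≤ N := le_trans (le_max_right _ _) (le_trans (le_max_left _ _) hN)
  have hNn₀ : 2 * n₀ + 2 ≤ N := le_trans (le_max_right _ _) hN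
  -- the long cycle
  obtain ⟨n, hn4, ⟨γ⟩⟩ := hN₁ N hNN₁
  have hsq : N / 2 ≤ Nat.sqrt n := half_le_sqrt hn4
  have hsqn : (N / 2) * (N / 2) ≤ n := Nat.le_sqrt.mp hsq
  have hn3 : 3 ≤ n := by
    have : 2 ≤ N / 2 := by omega
    nlinarith
  have hnn₀ : n₀ ≤ n := by
    have h1 : n₀ + 1 ≤ N / 2 := by omega
    have h2 : (n₀ + 1) * (n₀ + 1) ≤ (N / 2) * (N / 2) := Nat.mul_le_mul h1 h1
    nlinarith
  -- the Razborov–Smolensky parameter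
  set L : ℕ := Nat.log 2 N with hL
  have hL1 : 1 ≤ L := by rw [hL]; exact Nat.log_pos one_lt_two (by omega)
  set ℓ : ℕ := M + 2 * (L + 1) + E with hℓ
  have hℓ1 : 1 ≤ ℓ := by rw [hℓ]; omega
  -- degree: `((p-1)ℓ)^{d+1} ≤ ⌊√n⌋`
  have hdeg : ((p - 1) * ℓ) ^ (d + 1) ≤ 1 * Nat.sqrt n := by
    have hℓle : ℓ ≤ (E + 4) * (M + L) := by rw [hℓ]; exact ell_le hL1
    have hD : ((p - 1) * ℓ) ^ (d + 1) ≤ A * (M + L) ^ (d + 1) := by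
      calc ((p - 1) * ℓ) ^ (d + 1) ≤ ((p - 1) * ((E + 4) * (M + L))) ^ (d + 1) :=
            Nat.pow_le_pow_left (Nat.mul_le_mul_left _ hℓle) _
        _ = A * (M + L) ^ (d + 1) := by rw [hA, ← mul_assoc, mul_pow]
    have hB1 : 1 ≤ (M + L) ^ (d + 1) := Nat.one_le_pow _ _ (by omega)
    have h2 : 2 * ((p - 1) * ℓ) ^ (d + 1) + 2 ≤ N := by
      calc 2 * ((p - 1) * ℓ) ^ (d + 1) + 2 ≤ 2 * (A * (M + L) ^ (d + 1)) + 2 * (M + L) ^ (d + 1) := by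
            omega
        _ = (2 * A + 2) * (M + L) ^ (d + 1) := by ring
        _ ≤ N := hcM
    omega
  -- the polynomial-map bound from `RingHardLinSqrt` (slope `1`) at ring length `n`
  have hB : ∀ P : Fin (N * N) → Smolensky.CubeFn (ZMod p) n,
      (∀ j, P j ∈ Smolensky.lowDeg (ZMod p) n (((p - 1) * ℓ) ^ (d + 1))) →
        ((univ.filter fun x : Fin n → Bool =>
            (fun v => (fun j => decide (P j x = 1)) (finProdFinEquiv v)) ∈
              hlfSolutions (γ.ringInstance x)).card : ℝ) ≤ θ₀ * (2 : ℝ) ^ n := by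
    intro P hP
    -- the ring outputs of `P`
    let Q : Fin n → Smolensky.CubeFn (ZMod p) n := fun i => P (finProdFinEquiv (γ.toFun i))
    have hQ : ∀ i, Q i ∈ Smolensky.lowDeg (ZMod p) n (1 * Nat.sqrt n) :=
      fun i => Smolensky.lowDeg_mono hdeg (hP _)
    have hring := hn₀ n hnn₀ Q hQ
    refine le_trans ?_ hring
    exact_mod_cast card_le_card fun x hx => by
      simp only [mem_filter, mem_univ, true_and] at hx ⊢
      exact GridCycle.rel_of_mem_hlfSolutions hn3 x hx
  -- the relational Razborov–Smolensky lemma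
  obtain ⟨x, hx⟩ := Smolensky.exists_uniformProb_le hℓ1
    (fun x : Fin n → Bool => encodeHLF (γ.ringInstance x))
    (GridCycle.encodeHLF_ringInstance_subst γ)
    (fun j : Fin (N * N) => Cs (finProdFinEquiv.symm j))
    (fun j => hover _) (fun j => hdep _)
    (fun x z => (fun v => z (finProdFinEquiv v)) ∈ hlfSolutions (γ.ringInstance x)) hB
  refine ⟨γ.ringInstance x, GridCycle.ringInstance_isValid x, ?_⟩
  simp only [Equiv.symm_apply_apply] at hx
  refine hx.trans ?_
  -- the two error terms
  have h2n : (2 : ℝ) ^ n ≠ 0 := pow_ne_zero _ two_ne_zero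
  rw [mul_div_assoc, div_self h2n, mul_one]
  refine add_le_add le_rfl ?_
  have hpℓpos : (0 : ℝ) < (p : ℝ) ^ ℓ := by
    have : (0 : ℝ) < p := by exact_mod_cast hp.pos
    positivity
  have hsum : (∑ j : Fin (N * N), (((Cs (finProdFinEquiv.symm j)).size : ℝ) + 2)) ≤
      (N : ℝ) * N * ((2 : ℝ) ^ M + 2) := by
    calc (∑ j : Fin (N * N), (((Cs (finProdFinEquiv.symm j)).size : ℝ) + 2))
        ≤ ∑ _j : Fin (N * N), ((2 : ℝ) ^ M + 2) :=
          sum_le_sum fun j _ => by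
            have := hsize (finProdFinEquiv.symm j)
            exact add_le_add (by exact_mod_cast this) le_rfl
      _ = (N : ℝ) * N * ((2 : ℝ) ^ M + 2) := by
          rw [sum_const, card_univ, Fintype.card_fin, nsmul_eq_mul]
          push_cast
          ring
  calc (∑ j : Fin (N * N), (((Cs (finProdFinEquiv.symm j)).size : ℝ) + 2)) / (p : ℝ) ^ ℓ
      ≤ (N : ℝ) * N * ((2 : ℝ) ^ M + 2) / (p : ℝ) ^ ℓ := div_le_div_of_nonneg_right hsum hpℓpos.le
    _ ≤ δ := by
        rw [div_le_iff₀ hpℓpos, hℓ, hL]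
        exact error_le hp.two_le h3E hδpos.le

/-- **P3 `ExpBridgePlan p` — PROVED** for every prime `p`. -/
theorem expBridge (p : ℕ) [Fact p.Prime] : ExpBridgePlan p :=
  hlfNotFAC0ModExp_of_ringHardLinSqrt p

/-! ### The exponential statement implies the polynomial one -/

/-- Growth bookkeeping: for constants `c, b, d` and all large `N`, `c·(b·(log₂ N + 1))^{d+1} ≤ N`. -/
private theorem const_mul_logPow_le (c b d : ℕ) :
    ∃ N₀ : ℕ, ∀ N ≥ N₀, c * (b * (Nat.log 2 N + 1)) ^ (d + 1) ≤ N := by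
  obtain ⟨n₂, hn₂⟩ := TubePlanProof.logPow_le_natSqrt (d + 2)
  refine ⟨max (max n₂ 2) (2 ^ (c * (2 * b) ^ (d + 1))), fun N hN => ?_⟩
  have hN₂ : n₂ ≤ N := le_trans (le_max_left _ _) (le_trans (le_max_left _ _) hN)
  have hN2 : 2 ≤ N := le_trans (le_max_right _ _) (le_trans (le_max_left _ _) hN)
  have hNc : 2 ^ (c * (2 * b) ^ (d + 1)) ≤ N := le_trans (le_max_right _ _) hN
  set L : ℕ := Nat.log 2 N with hL
  have hcL : c * (2 * b) ^ (d + 1) ≤ L := by rw [hL]; exact Nat.le_log_of_pow_le one_lt_two hNc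
  have hL1 : L + 1 ≤ 2 * L := by
    have : 1 ≤ L := by rw [hL]; exact Nat.log_pos one_lt_two hN2
    omega
  calc c * (b * (L + 1)) ^ (d + 1) ≤ c * (b * (2 * L)) ^ (d + 1) :=
        Nat.mul_le_mul_left _ (Nat.pow_le_pow_left (Nat.mul_le_mul_left _ hL1) _)
    _ = c * (2 * b) ^ (d + 1) * L ^ (d + 1) := by rw [show b * (2 * L) = 2 * b * L by ring, mul_pow, mul_assoc]
    _ ≤ L * L ^ (d + 1) := Nat.mul_le_mul_right _ hcL
    _ = L ^ (d + 2) := by ring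
    _ ≤ Nat.sqrt N := hn₂ N hN₂
    _ ≤ N := Nat.sqrt_le_self N

/-- **`HLFNotFAC0ModExp p → HLFNotFAC0Mod p`** (first half of Sketch12b P6 `ExpGivesPoly`): a polynomial size
bound `s(N) ≤ 2^M` with `M = log₂ s(N) + 1 = O(log₂ N)`, and `c·(M + log₂ N)^{d+1} ≤ N` eventually. -/
theorem hlfNotFAC0Mod_of_exp (p : ℕ) (h : HLFNotFAC0ModExp p) : HLFNotFAC0Mod p := by
  obtain ⟨θ, hθ, H⟩ := h
  refine ⟨θ, hθ, fun d s => ?_⟩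
  obtain ⟨c, N₀, hc⟩ := H d
  obtain ⟨cs, ks, hcs⟩ := exists_eval_le_mul_pow_add s
  -- `s(N) < 2^{M N}` with `M N = log₂ s(N) + 1 ≤ cs + 1 + ks (log₂ N + 1)`
  obtain ⟨N₂, hN₂⟩ := const_mul_logPow_le c (cs + ks + 3) d
  refine ⟨max (max 1 N₀) N₂, fun N hN r Cs hover hdep hsize => ?_⟩
  have hN1 : 1 ≤ N := le_trans (le_max_left _ _) (le_trans (le_max_left _ _) hN)
  have hNN₀ : N₀ ≤ N := le_trans (le_max_right _ _) (le_trans (le_max_left _ _) hN)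
  have hNN₂ : N₂ ≤ N := le_trans (le_max_right _ _) hN
  set L : ℕ := Nat.log 2 N with hL
  set M : ℕ := Nat.log 2 (s.eval N) + 1 with hM
  -- size ≤ 2^M
  have hsM : s.eval N ≤ 2 ^ M := by rw [hM]; exact (Nat.lt_pow_succ_log_self one_lt_two _).le
  -- M ≤ cs + 2 + ks (L + 1)
  have hMle : M ≤ cs + 2 + ks * (L + 1) := by
    have h1 : s.eval N ≤ 2 ^ (cs + 1 + ks * (L + 1)) := by
      calc s.eval N ≤ cs * N ^ ks + cs := hcs N
        _ ≤ 2 * cs * N ^ ks := by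
            have : 1 ≤ N ^ ks := Nat.one_le_pow _ _ hN1
            nlinarith
        _ ≤ 2 ^ (cs + 1) * (2 ^ (L + 1)) ^ ks := by
            refine Nat.mul_le_mul ?_ (Nat.pow_le_pow_left (Nat.lt_pow_succ_log_self one_lt_two N).le _)
            have := @Nat.lt_two_pow_self cs
            rw [pow_succ]; omega
        _ = 2 ^ (cs + 1 + ks * (L + 1)) := by rw [← pow_mul, ← pow_add, mul_comm]
    have h2 : Nat.log 2 (s.eval N) ≤ cs + 1 + ks * (L + 1) := by
      calc Nat.log 2 (s.eval N) ≤ Nat.log 2 (2 ^ (cs + 1 + ks * (L + 1))) := Nat.log_mono_right h1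
        _ = cs + 1 + ks * (L + 1) := Nat.log_pow one_lt_two _
    rw [hM]; omega
  have hfit : c * (M + Nat.log 2 N) ^ (d + 1) ≤ N := by
    refine le_trans ?_ (hN₂ N hNN₂)
    apply Nat.mul_le_mul_left
    apply Nat.pow_le_pow_left
    rw [← hL]
    have hsplit : (cs + ks + 3) * (L + 1) = (cs + 2) * (L + 1) + ks * (L + 1) + (L + 1) := by ring
    rw [hsplit]
    have h1 : cs + 2 ≤ (cs + 2) * (L + 1) := Nat.le_mul_of_pos_right _ (by omega)
    omega
  exact hc N hNN₀ M hfit r Cs hover hdep fun v => (hsize v).trans hsM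

end Summit.QuantumAdvantage.AdviceFreeQNC0

end
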